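import Summits.Ventures.YMGap.Thresholds.OneLinkEigenModulus
import HarnessLib

/-!
# Venture YMGap — the one-link modulus beyond first order, part 2: the covariance of a Lipschitz observable with a
# linear statistic from ANY approximate Poisson solution, with `L²(ν_B)` bookkeeping

HONEST FRAMING: venture file of the cell `pub-ymgap` (QuantumFields programme), strong-coupling LATTICE bookkeeping for
`SU(N)` lattice Yang–Mills; nothing about the continuum or the mass gap in the Clay sense.  No number of record moves here:
this is the abstract engine («F3» of the cell note `HOME/p2/ONE-LINK-HIERARCHY.md`) that turns a polynomial `ψ` solving the
Poisson equation of the linear observable up to a remainder into a bound on the one-link Kantorovich–Rubinstein modulus.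

WHAT.  `ν_B(dg) ∝ exp(N Re tr(gB)) dg` on `SU(N)`, `‖B‖_op < 1/2`, `u = Re tr(· Δ)`, `S = N Re tr(· B)`, `λ₁ = N − 1/N`.
Suppose a smooth `ψ` satisfies ON `SU(N)`
  `Δ_LB ψ + N Γ(Re tr(· B), Re tr(· Δ)) = κ`  (a constant)                                    (hypothesis `hpois`)
— the tree's second-order solution `ψ₂` (`OneLinkCasimirTwo.lap_psiTwo_add_gam`) is the case in point, `ψ = 0` is NOT (that
is the first order, `OneLinkEigenModulus.cov_linear_le`).  Then (`cov_linear_le_of_poisson`) for every bounded measurable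
`L`-Lipschitz `φ`:
  `|Cov_ν(φ, N u)| ≤ (N²/(N²−1)) · L · [ ‖∇(u+ψ)‖_{L²(ν)} + ‖∇Γ(Re tr(· B), ψ)‖_{L²(ν)} / (1/2 − ‖B‖_op) ]`,
`‖∇f‖²_{L²(ν)} := ∫ Γ(f,f) dν`.  PROOF: `u = (−L_S(u+ψ) + N Γ(Re tr(·B), ψ) + κ)/λ₁` pointwise (tree `pot_eq_Gam_sub_genL` and
`hpois`); the `L_S`-term is an integration by parts (`integral_mul_exp_mul_genL`) bounded by Cauchy–Schwarz in `L²(e^S dg)`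
(`abs_integral_exp_mul_Gam_le`) — NOT by the worst-case Lipschitz constant; the remainder by Cauchy–Schwarz and the one-link
Poincaré inequality twice, in Lipschitz form for `φ` (`haarPoincare_SU`) and in GRADIENT form for the cubic remainder
(`poincare_pot`).  The two `L²(ν)` norms are left symbolic; bounding them by explicit functions of `(N, ‖B‖_op)` is the job of
the next files (cell note §4 (4.5)–(4.6)).

References: Shen–Zhu–Zhu, CMP 400 (2023) §4.1 (generator, Bakry–Émery constant `N(1/2 − ‖B‖_op)`); Bakry–Gentil–Ledoux,
Grundlehren 348, Prop. 4.8.1; cell notes `HOME/p2/ONE-LINK-MODULUS.md` §5, `HOME/p2/ONE-LINK-HIERARCHY.md` §3–§4.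
-/

noncomputable section

open scoped Matrix ComplexConjugate BigOperators ContDiff Matrix.Norms.Frobenius
open Matrix Complex Finset MeasureTheory ProbabilityTheory
open Literature.MathematicalPhysics.QuantumFieldTheory
open Literature.MathematicalPhysics.QuantumFieldTheory.SUNBakryEmery

namespace Summit.Ventures.YMGap.OneLinkEigen

variable {N : ℕ}

/-- `Γ(c Re tr(· B), G) = c Γ(Re tr(· B), G)`. [folklore] -/
theorem Gam_pot_left_smul (c : ℝ) (B : Matrix (Fin N) (Fin N) ℂ) (G : Matrix (Fin N) (Fin N) ℂ → ℝ) (Q : Matrix (Fin N) (Fin N) ℂ) :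
    Gam (pot c B) G Q = c * Gam (pot 1 B) G Q := by
  simp only [Gam, mul_sum]
  refine sum_congr rfl fun α _ => ?_
  have h1 : matD (frame α) (pot c B) Q = c * (Q * frame α * B).trace.re := congrFun (matD_const_mul_reTrMul c (frame α) B) Q
  have h2 : matD (frame α) (pot 1 B) Q = 1 * (Q * frame α * B).trace.re := congrFun (matD_const_mul_reTrMul 1 (frame α) B) Q
  rw [h1, h2]; ring

/-- `Γ(F, G + H) = Γ(F, G) + Γ(F, H)` for smooth `G, H`. [folklore] -/
theorem Gam_add_right (F : Matrix (Fin N) (Fin N) ℂ → ℝ) {G H : Matrix (Fin N) (Fin N) ℂ → ℝ} (hG : ContDiff ℝ ∞ G)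
    (hH : ContDiff ℝ ∞ H) (Q : Matrix (Fin N) (Fin N) ℂ) : Gam F (G + H) Q = Gam F G Q + Gam F H Q := by
  simp only [Gam, ← sum_add_distrib]
  refine sum_congr rfl fun α _ => ?_
  rw [matD_add hG hH, Pi.add_apply]; ring

/-- `L_S (F + G) = L_S F + L_S G` for smooth `F, G`. [folklore] -/
theorem genL_add_apply (S : Matrix (Fin N) (Fin N) ℂ → ℝ) {F G : Matrix (Fin N) (Fin N) ℂ → ℝ} (hF : ContDiff ℝ ∞ F)
    (hG : ContDiff ℝ ∞ G) (Q : Matrix (Fin N) (Fin N) ℂ) : genL S (F + G) Q = genL S F Q + genL S G Q := by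
  simp only [genL, Lap_add hF hG, Pi.add_apply, Gam_add_right S hF hG]
  ring

set_option maxHeartbeats 400000 in
/-- **Covariance with a linear statistic from an approximate Poisson solution, `L²(ν)` bookkeeping.**
`ν_B ∝ exp(N Re tr(gB)) dg` on `SU(N)` (`N ≥ 2`, `‖B‖_op < 1/2`); `ψ` smooth with
`Δ_LB ψ + N Γ(Re tr(·B), Re tr(·Δ)) ≡ κ` on `SU(N)`; `φ` bounded measurable `L`-Lipschitz (Frobenius).  Then
`|∫ φ · N Re tr(gΔ) dν − ∫ φ dν · ∫ N Re tr(gΔ) dν| ≤ (N²/(N²−1)) · L · ( √(∫ Γ(u+ψ, u+ψ) dν) + √(∫ Γ(c, c) dν) / (1/2 − ‖B‖_op) )`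
with `u = Re tr(·Δ)`, `c = Γ(Re tr(·B), ψ)`.  (First-order file: `cov_linear_le`; the second-order `ψ` is
`OneLinkCasimirTwo.lap_psiTwo_add_gam`.) [folklore] -/
theorem cov_linear_le_of_poisson (hN : 2 ≤ N) {B : Matrix (Fin N) (Fin N) ℂ} (hB : matrixOpNorm B < 1 / 2)
    (Δ : Matrix (Fin N) (Fin N) ℂ) {ψ : Matrix (Fin N) (Fin N) ℂ → ℝ} (hψ : ContDiff ℝ ∞ ψ) {κ : ℝ}
    (hpois : ∀ g : SUN N, Lap ψ g + (N : ℝ) * Gam (pot 1 B) (pot 1 Δ) g = κ)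
    (φ : SUN N → ℝ) {L : ℝ} (hφm : Measurable φ) (hφb : ∃ C, ∀ s, |φ s| ≤ C)
    (hL : 0 ≤ L) (hφL : ∀ a b, |φ a - φ b| ≤ L * suFrobDist a b) :
    |∫ s, φ s * ((N : ℝ) * ((s : Matrix (Fin N) (Fin N) ℂ) * Δ).trace.re)
          ∂(haarProbability (SUN N)).tilted (fun g => (N : ℝ) * ((g : Matrix (Fin N) (Fin N) ℂ) * B).trace.re) -
        (∫ s, φ s ∂(haarProbability (SUN N)).tilted (fun g => (N : ℝ) * ((g : Matrix (Fin N) (Fin N) ℂ) * B).trace.re)) *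
          ∫ s, (N : ℝ) * ((s : Matrix (Fin N) (Fin N) ℂ) * Δ).trace.re
            ∂(haarProbability (SUN N)).tilted (fun g => (N : ℝ) * ((g : Matrix (Fin N) (Fin N) ℂ) * B).trace.re)| ≤
      (N : ℝ) ^ 2 / ((N : ℝ) ^ 2 - 1) * L *
        (Real.sqrt (∫ g, Gam (pot 1 Δ + ψ) (pot 1 Δ + ψ) g
            ∂(haarProbability (SUN N)).tilted (fun g => (N : ℝ) * ((g : Matrix (Fin N) (Fin N) ℂ) * B).trace.re)) +
          Real.sqrt (∫ g, Gam (Gam (pot 1 B) ψ) (Gam (pot 1 B) ψ) g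
            ∂(haarProbability (SUN N)).tilted (fun g => (N : ℝ) * ((g : Matrix (Fin N) (Fin N) ℂ) * B).trace.re)) /
            (1 / 2 - matrixOpNorm B)) := by
  have hN0 : N ≠ 0 := by omega
  have hNpos : (0 : ℝ) < N := Nat.cast_pos.2 (Nat.pos_of_ne_zero hN0)
  have hN2 : (2 : ℝ) ≤ N := by exact_mod_cast hN
  set R : ℝ := matrixOpNorm B with hRdef
  have hR0 : 0 ≤ R := matrixOpNorm_nonneg B
  have hRpos : 0 < 1 / 2 - R := by linarith
  set lam : ℝ := (N : ℝ) - 1 / N with hlam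
  have hlampos : 0 < lam := by
    have : (1 : ℝ) / N ≤ 1 / 2 := by rw [div_le_div_iff₀ hNpos (by norm_num)]; linarith
    rw [hlam]; linarith
  have hlam_eq : (N : ℝ) / lam = (N : ℝ) ^ 2 / ((N : ℝ) ^ 2 - 1) := by
    rw [hlam]; field_simp
  -- the ambient objects
  set S : Matrix (Fin N) (Fin N) ℂ → ℝ := pot (N : ℝ) B with hSdef
  set u : Matrix (Fin N) (Fin N) ℂ → ℝ := pot 1 Δ with hudef
  set Ψ : Matrix (Fin N) (Fin N) ℂ → ℝ := pot 1 Δ + ψ with hΨdef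
  set c : Matrix (Fin N) (Fin N) ℂ → ℝ := Gam (pot 1 B) ψ with hcdef
  have hS : ContDiff ℝ ∞ S := contDiff_pot _ B
  have hu : ContDiff ℝ ∞ u := contDiff_pot _ Δ
  have hΨ : ContDiff ℝ ∞ Ψ := (contDiff_pot 1 Δ).add hψ
  have hc : ContDiff ℝ ∞ c := contDiff_Gam (contDiff_pot 1 B) hψ
  set ν : Measure (SUN N) :=
    (haarProbability (SUN N)).tilted (fun g => (N : ℝ) * ((g : Matrix (Fin N) (Fin N) ℂ) * B).trace.re) with hν
  have hSg : ∀ g : SUN N, (N : ℝ) * ((g : Matrix (Fin N) (Fin N) ℂ) * B).trace.re = S g := fun g => rfl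
  have hexpc : Continuous fun g : SUN N => Real.exp (S g) := Real.continuous_exp.comp (continuous_restrict hS)
  have hexpi : Integrable (fun g : SUN N => Real.exp ((N : ℝ) * ((g : Matrix (Fin N) (Fin N) ℂ) * B).trace.re))
      (haarProbability (SUN N)) := integrable_of_continuous_SUN hexpc _
  haveI : IsProbabilityMeasure ν := isProbabilityMeasure_tilted hexpi
  set Z : ℝ := ∫ g : SUN N, Real.exp (S g) ∂(haarSU N) with hZ
  have hZpos : 0 < Z := integral_exp_pos (integrable_of_continuous_SUN hexpc _)
  have htilt : ∀ f : SUN N → ℝ, ∫ g, f g ∂ν = (∫ g : SUN N, Real.exp (S g) * f g ∂(haarSU N)) / Z := fun f => by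
    rw [hν]; exact integral_tilted_eq_div _ f
  -- the observables on `SU(N)`
  set w : SUN N → ℝ := fun s => (N : ℝ) * ((s : Matrix (Fin N) (Fin N) ℂ) * Δ).trace.re with hw
  set cr : SUN N → ℝ := fun g => c g with hcr
  set Lg : SUN N → ℝ := fun g => genL S Ψ g with hLg
  have hcrc : Continuous cr := continuous_restrict hc
  have hLgc : Continuous Lg := continuous_restrict (contDiff_genL hS hΨ)
  have hwc : Continuous w := continuous_const.mul (continuous_re_trace_su_mul Δ)
  have hφc : Continuous φ := continuous_of_lipschitz_suFrobDist hφL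
  -- the pointwise identity `w = (N/λ)(κ + N c − L_S Ψ)` on `SU(N)`
  have hweq : w = fun g => ((N : ℝ) / lam) * ((N : ℝ) * cr g - Lg g) + ((N : ℝ) / lam) * κ := by
    funext g
    have h1 : w g = (N : ℝ) * pot 1 Δ g := by simp only [hw, pot, one_mul]
    have h2 := pot_eq_Gam_sub_genL hN S 1 Δ (g : Matrix (Fin N) (Fin N) ℂ)
    have h3 : Gam S (pot 1 Δ) g = (N : ℝ) * Gam (pot 1 B) (pot 1 Δ) g := by rw [hSdef, Gam_pot_left_smul]
    have h4 : (N : ℝ) * Gam (pot 1 B) (pot 1 Δ) g = κ - Lap ψ g := by linarith [hpois g]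
    have h5 : Lg g = genL S (pot 1 Δ) g + (Lap ψ g + (N : ℝ) * cr g) := by
      show genL S Ψ g = _
      rw [hΨdef, genL_add_apply S (contDiff_pot 1 Δ) hψ]
      show _ + (Lap ψ g + Gam S ψ g) = _
      rw [hSdef, Gam_pot_left_smul (N : ℝ) B ψ]
    have h6 : genL S (pot 1 Δ) (g : Matrix (Fin N) (Fin N) ℂ) = Lg g - Lap ψ g - (N : ℝ) * cr g := by rw [h5]; ring
    rw [h1, h2, h3, h4, h6]
    simp only [hlam]
    field_simp
    ring
  -- `L²` memberships
  have mφ : MemLp φ 2 ν := by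
    obtain ⟨C, hC⟩ := hφb
    exact MemLp.of_bound hφm.aestronglyMeasurable C (ae_of_all _ fun g => (Real.norm_eq_abs _).le.trans (hC g))
  have mcr : MemLp cr 2 ν := memLp_two_of_continuous hcrc ν
  have mLg : MemLp Lg 2 ν := memLp_two_of_continuous hLgc ν
  have mw : MemLp w 2 ν := memLp_two_of_continuous hwc ν
  -- the raw covariance is `cov[φ, w; ν]`
  have hcovw : ∫ s, φ s * w s ∂ν - (∫ s, φ s ∂ν) * ∫ s, w s ∂ν = cov[φ, w; ν] := by
    rw [covariance_eq_sub mφ mw]; rfl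
  -- split
  have hsplit : cov[φ, w; ν] = ((N : ℝ) / lam) * ((N : ℝ) * cov[φ, cr; ν] - cov[φ, Lg; ν]) := by
    have hfc : Continuous fun g : SUN N => (N : ℝ) / lam * ((N : ℝ) * cr g - Lg g) :=
      continuous_const.mul ((continuous_const.mul hcrc).sub hLgc)
    have hfi : Integrable (fun g : SUN N => (N : ℝ) / lam * ((N : ℝ) * cr g - Lg g)) ν :=
      (memLp_two_of_continuous hfc ν).integrable one_le_two
    rw [hweq, covariance_add_const_right hfi]
    have e : (fun g : SUN N => (N : ℝ) / lam * ((N : ℝ) * cr g - Lg g)) = ((N : ℝ) / lam) • (((N : ℝ) • cr) - Lg) := by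
      funext g; simp only [Pi.smul_apply, Pi.sub_apply, smul_eq_mul]
    rw [e, covariance_smul_right, covariance_sub_right mφ (mcr.const_smul _) mLg, covariance_smul_right]
  -- (1) the integration-by-parts term in `L²(ν)`: `|cov[φ, Lg]| ≤ L √(∫ Γ(Ψ,Ψ) dν)`
  have hLg0 : ∫ g, Lg g ∂ν = 0 := by
    rw [htilt, integral_exp_mul_genL_eq_zero hN0 hS hΨ, zero_div]
  have hcovLg : cov[φ, Lg; ν] = ∫ g, φ g * Lg g ∂ν := by
    rw [covariance_eq_sub mφ mLg, hLg0, mul_zero, sub_zero]; rfl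
  obtain ⟨CL, hCL⟩ := exists_abs_le_of_continuous hLgc
  have hCL0 : 0 ≤ CL := (abs_nonneg _).trans (hCL 1)
  have hwint : ∀ {f : SUN N → ℝ}, Continuous f → Integrable (fun g : SUN N => Real.exp (S g) * f g) (haarSU N) :=
    fun hf => integrable_of_continuous_SUN (hexpc.mul hf) _
  set GΨ : ℝ := ∫ g, Gam Ψ Ψ g ∂ν with hGΨ
  have hGΨZ : ∫ g : SUN N, Real.exp (S g) * Gam Ψ Ψ g ∂(haarSU N) = GΨ * Z := by
    rw [hGΨ, htilt, div_mul_cancel₀ _ hZpos.ne']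
  have hGΨ0 : 0 ≤ GΨ := by
    rw [hGΨ]; exact integral_nonneg fun g => Gam_self_nonneg Ψ g
  have hIBP : |cov[φ, Lg; ν]| ≤ L * Real.sqrt GΨ := by
    rw [hcovLg]
    refine le_of_forall_pos_le_add fun δ hδ => ?_
    set ε : ℝ := δ / (CL + 1) with hε
    have hεpos : 0 < ε := div_pos hδ (by linarith)
    obtain ⟨F, hF, hΓF, hFφ⟩ := exists_smooth_approx hL hφL hεpos hN0
    have hFc : Continuous fun g : SUN N => F g := continuous_restrict hF
    have hFLg : ∫ g, F g * Lg g ∂ν = -(∫ g : SUN N, Real.exp (S g) * Gam F Ψ g ∂(haarSU N)) / Z := by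
      rw [htilt]
      congr 1
      have : (fun g : SUN N => Real.exp (S g) * (F g * Lg g)) = fun g : SUN N => F g * (Real.exp (S g) * genL S Ψ g) := by
        funext g; simp only [hLg]; ring
      rw [this, integral_mul_exp_mul_genL hN0 hS hF hΨ]
    have hFF : ∫ g : SUN N, Real.exp (S g) * Gam F F g ∂(haarSU N) ≤ L ^ 2 * Z := by
      calc ∫ g : SUN N, Real.exp (S g) * Gam F F g ∂(haarSU N)
          ≤ ∫ g : SUN N, Real.exp (S g) * L ^ 2 ∂(haarSU N) :=
            integral_mono (hwint (continuous_restrict (contDiff_Gam hF hF))) (hwint continuous_const)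
              fun g => mul_le_mul_of_nonneg_left (hΓF g) (Real.exp_pos _).le
        _ = L ^ 2 * Z := by rw [integral_mul_const, hZ, mul_comm]
    have hA : |∫ g, F g * Lg g ∂ν| ≤ L * Real.sqrt GΨ := by
      rw [hFLg, abs_div, abs_neg, abs_of_pos hZpos, div_le_iff₀ hZpos]
      calc |∫ g : SUN N, Real.exp (S g) * Gam F Ψ g ∂(haarSU N)|
          ≤ Real.sqrt (∫ g : SUN N, Real.exp (S g) * Gam F F g ∂(haarSU N)) *
              Real.sqrt (∫ g : SUN N, Real.exp (S g) * Gam Ψ Ψ g ∂(haarSU N)) := abs_integral_exp_mul_Gam_le hS hF hΨ _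
        _ ≤ Real.sqrt (L ^ 2 * Z) * Real.sqrt (GΨ * Z) := by
            rw [hGΨZ]
            exact mul_le_mul_of_nonneg_right (Real.sqrt_le_sqrt hFF) (Real.sqrt_nonneg _)
        _ = L * Real.sqrt GΨ * Z := by
            rw [Real.sqrt_mul (sq_nonneg _), Real.sqrt_sq hL, Real.sqrt_mul hGΨ0]
            have hz := Real.mul_self_sqrt hZpos.le
            linear_combination (L * Real.sqrt GΨ) * hz
    -- `∫ (φ - F) Lg dν` is small
    have i1 : Integrable (fun g : SUN N => φ g * Lg g) ν := mφ.integrable_mul mLg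
    have i2 : Integrable (fun g : SUN N => F g * Lg g) ν := (memLp_two_of_continuous hFc ν).integrable_mul mLg
    have hB' : |∫ g, φ g * Lg g ∂ν - ∫ g, F g * Lg g ∂ν| ≤ ε * CL := by
      rw [← integral_sub i1 i2]
      calc |∫ g, (φ g * Lg g - F g * Lg g) ∂ν| ≤ ∫ g, |φ g * Lg g - F g * Lg g| ∂ν := abs_integral_le_integral_abs
        _ ≤ ∫ g, ε * CL ∂ν := by
            refine integral_mono (i1.sub i2).abs (integrable_const _) fun g => ?_
            rw [← sub_mul, abs_mul]
            refine mul_le_mul ?_ (hCL g) (abs_nonneg _) hεpos.le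
            rw [abs_sub_comm]; exact hFφ g
        _ = ε * CL := by simp
    have hεCL : ε * CL ≤ δ := by
      rw [hε, div_mul_eq_mul_div, div_le_iff₀ (by linarith)]
      nlinarith
    calc |∫ g, φ g * Lg g ∂ν| = |(∫ g, φ g * Lg g ∂ν - ∫ g, F g * Lg g ∂ν) + ∫ g, F g * Lg g ∂ν| := by ring_nf
      _ ≤ |∫ g, φ g * Lg g ∂ν - ∫ g, F g * Lg g ∂ν| + |∫ g, F g * Lg g ∂ν| := abs_add_le _ _
      _ ≤ δ + L * Real.sqrt GΨ := add_le_add (hB'.trans hεCL) hA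
      _ = L * Real.sqrt GΨ + δ := add_comm _ _
  -- (2) the remainder: `|cov[φ, c]| ≤ L √(∫ Γ(c,c) dν) / (N (1/2 − R))` (Poincaré twice: Lipschitz form for `φ`,
  --     gradient form for `c`)
  have hK : 0 < (N : ℝ) * (1 / 2 - R) := mul_pos hNpos hRpos
  have hvarφ : Var[φ; ν] ≤ L ^ 2 / ((N : ℝ) * (1 / 2 - R)) := haarPoincare_SU hN B hB φ L hL hφL
  set Gc : ℝ := ∫ g, Gam c c g ∂ν with hGc
  have hGc0 : 0 ≤ Gc := by rw [hGc]; exact integral_nonneg fun g => Gam_self_nonneg c g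
  have hvarc : Var[cr; ν] ≤ Gc / ((N : ℝ) * (1 / 2 - R)) := by
    have hK' : 0 < (N : ℝ) / 2 - |(N : ℝ)| * matrixOpNorm B := by
      rw [abs_of_pos hNpos]; nlinarith
    have hP := poincare_pot hN0 (N : ℝ) B hK' hc
    set m : ℝ := (∫ g : SUN N, Real.exp (pot (N : ℝ) B g) * c g ∂(haarSU N)) /
      (∫ g : SUN N, Real.exp (pot (N : ℝ) B g) ∂(haarSU N)) with hm
    have hmean : ∫ g, cr g ∂ν = m := by rw [htilt]
    have hvar : Var[cr; ν] = (∫ g : SUN N, Real.exp (S g) * (c g - m) ^ 2 ∂(haarSU N)) / Z := by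
      rw [ProbabilityTheory.variance_eq_integral hcrc.aemeasurable, hmean, htilt]
    have hKeq : (N : ℝ) / 2 - |(N : ℝ)| * matrixOpNorm B = (N : ℝ) * (1 / 2 - R) := by
      rw [abs_of_pos hNpos, hRdef]; ring
    rw [hKeq] at hP
    rw [hvar, div_le_div_iff₀ hZpos hK, hGc, htilt, div_mul_eq_mul_div, le_div_iff₀ hZpos]
    calc (∫ g : SUN N, Real.exp (S g) * (c g - m) ^ 2 ∂(haarSU N)) * ((N : ℝ) * (1 / 2 - R)) * Z
        = ((N : ℝ) * (1 / 2 - R) * ∫ g : SUN N, Real.exp (pot (N : ℝ) B g) * (c g - m) ^ 2 ∂(haarSU N)) * Z := by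
          rw [hSdef]; ring
      _ ≤ (∫ g : SUN N, Real.exp (pot (N : ℝ) B g) * Gam c c g ∂(haarSU N)) * Z :=
          mul_le_mul_of_nonneg_right hP hZpos.le
      _ = (∫ g : SUN N, Real.exp (S g) * Gam c c g ∂(haarSU N)) * Z := by rw [hSdef]
  have hPoinc : |cov[φ, cr; ν]| ≤ L * Real.sqrt Gc / ((N : ℝ) * (1 / 2 - R)) := by
    have hcs : |cov[φ, cr; ν]| ≤ Real.sqrt (Var[φ; ν] * Var[cr; ν]) := by
      rw [← Real.sqrt_sq_eq_abs]; exact Real.sqrt_le_sqrt (cov_sq_le_var_mul_var mφ mcr)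
    refine hcs.trans ?_
    have hprod : Var[φ; ν] * Var[cr; ν] ≤ (L * Real.sqrt Gc / ((N : ℝ) * (1 / 2 - R))) ^ 2 := by
      calc Var[φ; ν] * Var[cr; ν] ≤ (L ^ 2 / ((N : ℝ) * (1 / 2 - R))) * (Gc / ((N : ℝ) * (1 / 2 - R))) :=
            mul_le_mul hvarφ hvarc (variance_nonneg _ _) (by positivity)
        _ = (L * Real.sqrt Gc / ((N : ℝ) * (1 / 2 - R))) ^ 2 := by
            rw [div_pow, mul_pow, Real.sq_sqrt hGc0]; field_simp
    calc Real.sqrt (Var[φ; ν] * Var[cr; ν]) ≤ Real.sqrt ((L * Real.sqrt Gc / ((N : ℝ) * (1 / 2 - R))) ^ 2) :=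
          Real.sqrt_le_sqrt hprod
      _ = L * Real.sqrt Gc / ((N : ℝ) * (1 / 2 - R)) := Real.sqrt_sq (by positivity)
  -- (3) assemble
  rw [hcovw, hsplit, abs_mul, abs_of_pos (div_pos hNpos hlampos), hlam_eq]
  have hfin : |(N : ℝ) * cov[φ, cr; ν] - cov[φ, Lg; ν]| ≤
      (N : ℝ) * (L * Real.sqrt Gc / ((N : ℝ) * (1 / 2 - R))) + L * Real.sqrt GΨ := by
    refine (abs_sub _ _).trans (add_le_add ?_ hIBP)
    rw [abs_mul, abs_of_pos hNpos]
    exact mul_le_mul_of_nonneg_left hPoinc hNpos.le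
  have hN21 : (0 : ℝ) < (N : ℝ) ^ 2 - 1 := by nlinarith
  calc (N : ℝ) ^ 2 / ((N : ℝ) ^ 2 - 1) * |(N : ℝ) * cov[φ, cr; ν] - cov[φ, Lg; ν]|
      ≤ (N : ℝ) ^ 2 / ((N : ℝ) ^ 2 - 1) * ((N : ℝ) * (L * Real.sqrt Gc / ((N : ℝ) * (1 / 2 - R))) + L * Real.sqrt GΨ) :=
        mul_le_mul_of_nonneg_left hfin (by positivity)
    _ = (N : ℝ) ^ 2 / ((N : ℝ) ^ 2 - 1) * L * (Real.sqrt GΨ + Real.sqrt Gc / (1 / 2 - R)) := by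
        field_simp
        ring

end Summit.Ventures.YMGap.OneLinkEigen
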